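import Mathlib
import Summits.CriticalPhenomena.CardyFormulaZ2.Theorems.CardyMagicRigidityNestingRigidityGapCrossing
import Summits.CriticalPhenomena.CardyFormulaZ2.Theorems.CardyMagicRigidityNestingRigidityLoopCrossCountT
import HarnessLib

/-!
# Crux `MagicFormulaT`, line `Sketch` (v7): the two geometric a priori bounds
# (`apriori_window`, `apriori_sausage`) of stub `stub_aprioriBounds`

Crux `Summit.CriticalPhenomena.CardyFormulaZ2.Theses.CardyMagicRigidity.MagicFormulaT`
(stmt-CriticalPhenomena-4836), line `Sketch`, skeleton v7, registered sub-goals (iii) and (iv) of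
`stub_aprioriBounds` for the site-`𝕋` loop ensemble `siteLoopConfig δ` under
`triSitePercolation half` (`= tEns.X δ`, `tEns.P` of crux `NestingRigidity`, by `rfl`):

* `apriori_window` — **loops meeting `B̄(0, R)` stay in a large window w.h.p., uniformly in the
  mesh**: a loop meeting `B̄(0, R)` and leaving `B(0, D)` crosses the annulus `A(0; max R 1, D)`,
  an event of probability `≤ C ((max R 1)/D)^c` for `c₀ δ ≤ max R 1`
  (`GapCrossing.measure_loop_cross_le_tEns`, the RSW one-arm bound of Bollobás–Riordan via the
  tree's proved `tri_annulusCrossing_bound_holds`); choose `D` with `C ((max R 1)/D)^c ≤ κ`.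
* `apriori_sausage` — **thin sausages**: w.h.p. as `ε → 0`, uniformly in small meshes, every loop
  of diameter `≥ η` meeting `B̄(0, R + 1)` has an `ε`-neighbourhood of area `≤ τ` inside
  `B̄(0, R)`.  Deterministic core (`volume_real_sausage_le_sum`): cover `B̄(0, R)` by the closed
  discs `B̄(y, 2ε)`, `y ∈ εℤ²`, `‖y‖∞ ≤ ⌈|R|/ε⌉ ε`; if such a disc meets the `ε`-sausage of a
  compact `K` with `diam K ≥ η > 0` then `K` meets `B̄(y, 3ε)` and leaves `B(y, η/3)`; each disc
  has area `4πε² ≤ 16ε²`.  Hence the sausage area of a loop `u` is at most `16 ε² · Σ_y N_y` where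
  `N_y` is the number of loops meeting `B̄(y, 3ε)` and leaving `B(y, η/3)`, whose expectation is
  `≤ C (9ε/η)^c` for `c₀ δ ≤ 3ε`, `36 ε ≤ η` (first-moment two-arm bound
  `integral_ncard_loops_cross_le_tEns`); Markov's inequality and `#{y} ε² ≤ (2|R| + 3)²` give a
  bound `A ε^c ≤ κ` for `ε ≤ ε₀(R, η, τ, κ)`.

No measurability of the loop events is needed (outer measure monotonicity into measurable /
Markov events).
-/

noncomputable section

namespace Summit.CriticalPhenomena.CardyFormulaZ2.Cruxes.MagicFormulaT.LineSketch

open MeasureTheory Filter Set Metric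
open scoped Real Topology BigOperators ENNReal
open Literature.Probability.RandomPlanarGeometry Literature.Probability.Percolation
  Literature.Probability.LatticeModels
open Summit.CriticalPhenomena.CardyFormulaZ2.Cruxes.NestingRigidity.RingCloudTomography

/-! ## (iii) The window bound -/

/-- **A priori bound (iii), window** (registered sub-goal `apriori_window` of `stub_aprioriBounds`,
line `Sketch` v7): for every `R` and `κ > 0` there are `D > 0` and `δ₀ > 0` such that for all meshes
`0 < δ ≤ δ₀` the probability that some loop of `siteLoopConfig δ` meets `B̄(0, R)` but is not
contained in `B(0, D)` is at most `κ`.  Such a loop meets `B̄(0, max R 1)` and `ℂ ∖ B(0, D)`, and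
`GapCrossing.measure_loop_cross_le_tEns` bounds this by `C ((max R 1)/D)^c ≤ κ` for
`D = (max R 1) / (min 1 (κ/C))^{1/c}` and `c₀ δ ≤ max R 1`. -/
theorem apriori_window : ∀ (R κ : ℝ), 0 < κ → ∃ D δ₀ : ℝ, 0 < D ∧ 0 < δ₀ ∧ ∀ δ : ℝ, 0 < δ → δ ≤ δ₀ →
    (triSitePercolation half) {ω | ∃ u ∈ (siteLoopConfig δ ω).loops,
      (u.range ∩ Metric.closedBall (0 : ℂ) R).Nonempty ∧ ¬ (u.range ⊆ Metric.ball (0 : ℂ) D)} ≤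
      ENNReal.ofReal κ := by
  intro R κ hκ
  obtain ⟨c, C, c₀, hc, hC, hc₀, hP⟩ := GapCrossing.measure_loop_cross_le_tEns
  -- a radius `a ≥ 1` with `B̄(0, R) ⊆ B̄(0, a)`
  set a : ℝ := max R 1 with ha
  have ha0 : 0 < a := lt_of_lt_of_le one_pos (le_max_right R 1)
  -- the target ratio `s = (a / D)^c ≤ κ / C`
  set s : ℝ := min 1 (κ / C) with hs
  have hs0 : 0 < s := lt_min one_pos (div_pos hκ hC)
  have hsc : 0 < s ^ (1 / c) := Real.rpow_pos_of_pos hs0 _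
  set D : ℝ := a / s ^ (1 / c) with hD
  have hD0 : 0 < D := div_pos ha0 hsc
  refine ⟨D, a / c₀, hD0, div_pos ha0 hc₀, fun δ hδ hδ₀ ↦ ?_⟩
  have hc₀δ : c₀ * δ ≤ a := by
    calc c₀ * δ ≤ c₀ * (a / c₀) := mul_le_mul_of_nonneg_left hδ₀ hc₀.le
      _ = a := mul_div_cancel₀ a hc₀.ne'
  have hsub : {ω | ∃ u ∈ (siteLoopConfig δ ω).loops,
      (u.range ∩ Metric.closedBall (0 : ℂ) R).Nonempty ∧ ¬ (u.range ⊆ Metric.ball (0 : ℂ) D)} ⊆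
      {ω | ∃ u ∈ (tEns.X δ ω).loops, (u.range ∩ closedBall (0 : ℂ) a).Nonempty ∧
        (u.range ∩ (ball (0 : ℂ) D)ᶜ).Nonempty} := by
    rintro ω ⟨u, hu, ⟨z, hzu, hzR⟩, hnot⟩
    exact ⟨u, hu, ⟨z, hzu, closedBall_subset_closedBall (le_max_left R 1) hzR⟩,
      Set.inter_compl_nonempty_iff.2 hnot⟩
  have haD : a / D = s ^ (1 / c) := by
    rw [hD]
    field_simp
  have hratio : C * (a / D) ^ c ≤ κ := by
    rw [haD, ← Real.rpow_mul hs0.le, one_div_mul_cancel hc.ne', Real.rpow_one]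
    calc C * s ≤ C * (κ / C) := mul_le_mul_of_nonneg_left (min_le_right _ _) hC.le
      _ = κ := mul_div_cancel₀ κ hC.ne'
  calc (triSitePercolation half) {ω | ∃ u ∈ (siteLoopConfig δ ω).loops,
        (u.range ∩ Metric.closedBall (0 : ℂ) R).Nonempty ∧ ¬ (u.range ⊆ Metric.ball (0 : ℂ) D)}
      ≤ tEns.P {ω | ∃ u ∈ (tEns.X δ ω).loops, (u.range ∩ closedBall (0 : ℂ) a).Nonempty ∧
          (u.range ∩ (ball (0 : ℂ) D)ᶜ).Nonempty} := measure_mono hsub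
    _ ≤ ENNReal.ofReal (C * (a / D) ^ c) := hP 0 a D δ hδ hc₀δ hD0
    _ ≤ ENNReal.ofReal κ := ENNReal.ofReal_le_ofReal hratio

/-! ## (iv) Thin sausages -/

/-- **Deterministic core of the sausage bound (grid covering).**  Let `K ⊆ ℂ` be compact and
non-empty with `diam K ≥ η > 0`, `ε > 0`, and let `F ≥ 0` be a weight on the grid `εℤ²` which is
at least `16 ε²` at every grid point `y = (p₁ ε, p₂ ε)` such that `K` meets `B̄(y, 3ε)` and leaves
`B(y, η/3)`.  Then the area of the `ε`-sausage of `K` inside `B̄(0, R)` is at most the total weight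
of the grid points with `|p₁|, |p₂| ≤ ⌈|R|/ε⌉`.  Proof: a point `z` of the sausage in `B̄(0, R)`
lies in the disc `B̄(y, 2ε)` around `y = (⌊Re z/ε⌋ ε, ⌊Im z/ε⌋ ε)` (a grid point of the box); if
this disc meets the sausage then `infDist y K ≤ 3ε` (attained, `K` compact) and `K ⊄ B(y, η/3)`
(else `diam K ≤ 2η/3`); the disc has area `π (2ε)² ≤ 16 ε²` (`Complex.volume_closedBall`). -/
theorem volume_real_sausage_le_sum {K : Set ℂ} (hK : IsCompact K) (hKne : K.Nonempty)
    {ε η : ℝ} (R : ℝ) (hε : 0 < ε) (hη : 0 < η) (hηK : η ≤ diam K) (F : ℤ × ℤ → ℝ)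
    (hF0 : ∀ p, 0 ≤ F p)
    (hF : ∀ p : ℤ × ℤ, (K ∩ closedBall (⟨p.1 * ε, p.2 * ε⟩ : ℂ) (3 * ε)).Nonempty →
      (K ∩ (ball (⟨p.1 * ε, p.2 * ε⟩ : ℂ) (η / 3))ᶜ).Nonempty → 16 * ε ^ 2 ≤ F p) :
    volume.real ({z : ℂ | infDist z K ≤ ε} ∩ closedBall (0 : ℂ) R) ≤
      ∑ p ∈ Finset.Icc (-(⌈|R| / ε⌉₊ : ℤ)) ⌈|R| / ε⌉₊ ×ˢ Finset.Icc (-(⌈|R| / ε⌉₊ : ℤ)) ⌈|R| / ε⌉₊,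
        F p := by
  set N : ℕ := ⌈|R| / ε⌉₊ with hN
  set box : Finset (ℤ × ℤ) := Finset.Icc (-(N : ℤ)) N ×ˢ Finset.Icc (-(N : ℤ)) N with hbox
  set g : ℤ × ℤ → ℂ := fun p ↦ ⟨p.1 * ε, p.2 * ε⟩ with hg
  set S : Set ℂ := {z : ℂ | infDist z K ≤ ε} ∩ closedBall (0 : ℂ) R with hS
  have hRN : |R| / ε ≤ N := Nat.le_ceil _
  -- the floor of a coordinate of a point of `B̄(0, R)` lies in the box
  have hmem : ∀ t : ℝ, |t| ≤ |R| → ⌊t / ε⌋ ∈ Finset.Icc (-(N : ℤ)) N := by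
    intro t ht
    obtain ⟨ht1, ht2⟩ := abs_le.1 ht
    rw [Finset.mem_Icc]
    constructor
    · rw [Int.le_floor, Int.cast_neg, Int.cast_natCast, le_div_iff₀ hε]
      have h1 : |R| ≤ N * ε := by rwa [div_le_iff₀ hε] at hRN
      linarith
    · have h1 : (⌊t / ε⌋ : ℝ) ≤ t / ε := Int.floor_le _
      have h2 : t / ε ≤ |R| / ε := div_le_div_of_nonneg_right ht2 hε.le
      have h3 : ((⌊t / ε⌋ : ℤ) : ℝ) ≤ (N : ℝ) := h1.trans (h2.trans hRN)
      exact_mod_cast h3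
  -- a coordinate is within `ε` of its grid value
  have hcoord : ∀ t : ℝ, |t - ⌊t / ε⌋ * ε| ≤ ε := by
    intro t
    have h1 : (⌊t / ε⌋ : ℝ) * ε ≤ t := (le_div_iff₀ hε).1 (Int.floor_le _)
    have h2 : t < ((⌊t / ε⌋ : ℝ) + 1) * ε := (div_lt_iff₀ hε).1 (Int.lt_floor_add_one _)
    rw [abs_le]
    constructor <;> linarith
  -- every point of `S` is within `2ε` of a grid point of the box
  have hcover : S ⊆ ⋃ p ∈ box, closedBall (g p) (2 * ε) ∩ S := by
    intro z hz
    have hzR : ‖z‖ ≤ R := mem_closedBall_zero_iff.1 hz.2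
    have hre : |z.re| ≤ |R| := (Complex.abs_re_le_norm z).trans (hzR.trans (le_abs_self R))
    have him : |z.im| ≤ |R| := (Complex.abs_im_le_norm z).trans (hzR.trans (le_abs_self R))
    have hdist : dist z (g (⌊z.re / ε⌋, ⌊z.im / ε⌋)) ≤ 2 * ε := by
      rw [Complex.dist_eq]
      refine (Complex.norm_le_abs_re_add_abs_im _).trans ?_
      have h1 := hcoord z.re
      have h2 := hcoord z.im
      simp only [hg, Complex.sub_re, Complex.sub_im] at h1 h2 ⊢
      linarith
    refine Set.mem_iUnion₂.2 ⟨(⌊z.re / ε⌋, ⌊z.im / ε⌋), ?_, mem_closedBall.2 hdist, hz⟩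
    exact Finset.mem_product.2 ⟨hmem _ hre, hmem _ him⟩
  have hfin : volume (⋃ p ∈ box, closedBall (g p) (2 * ε) ∩ S) ≠ ∞ := by
    refine (lt_of_le_of_lt (measure_biUnion_finset_le box _) ?_).ne
    refine ENNReal.sum_lt_top.2 fun p _ ↦ ?_
    exact lt_of_le_of_lt (measure_mono Set.inter_subset_left) measure_closedBall_lt_top
  -- the area of one disc
  have hdisc : ∀ y : ℂ, volume.real (closedBall y (2 * ε)) ≤ 16 * ε ^ 2 := by
    intro y
    rw [measureReal_def, Complex.volume_closedBall, ENNReal.toReal_mul, ENNReal.toReal_pow,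
      ENNReal.toReal_ofReal (by positivity), ENNReal.coe_toReal, NNReal.coe_real_pi]
    nlinarith [Real.pi_le_four, sq_nonneg ε]
  calc volume.real S
      ≤ volume.real (⋃ p ∈ box, closedBall (g p) (2 * ε) ∩ S) := measureReal_mono hcover hfin
    _ ≤ ∑ p ∈ box, volume.real (closedBall (g p) (2 * ε) ∩ S) :=
        measureReal_biUnion_finset_le box _
    _ ≤ ∑ p ∈ box, F p := Finset.sum_le_sum fun p _ ↦ ?_
  by_cases hne : (closedBall (g p) (2 * ε) ∩ S).Nonempty
  · -- the disc meets the sausage: `K` meets `B̄(g p, 3ε)` and leaves `B(g p, η/3)`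
    obtain ⟨z, hzg, hzK, -⟩ := hne
    obtain ⟨k, hkK, hk⟩ := hK.exists_infDist_eq_dist hKne z
    have hzK' : infDist z K ≤ ε := hzK
    have h1 : (K ∩ closedBall (g p) (3 * ε)).Nonempty := by
      refine ⟨k, hkK, mem_closedBall.2 ?_⟩
      have := mem_closedBall.1 hzg
      linarith [dist_triangle k z (g p), dist_comm k z]
    have h2 : (K ∩ (ball (g p) (η / 3))ᶜ).Nonempty := by
      by_contra h
      rw [Set.inter_compl_nonempty_iff, not_not] at h
      have hd := (diam_mono h isBounded_ball).trans (diam_ball (x := g p) (by positivity))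
      linarith
    exact (measureReal_mono Set.inter_subset_left measure_closedBall_lt_top.ne).trans
      ((hdisc (g p)).trans (hF p h1 h2))
  · rw [Set.not_nonempty_iff_eq_empty.1 hne, measureReal_empty]
    exact hF0 p

/-- **A priori bound (iv), thin sausages** (registered sub-goal `apriori_sausage` of
`stub_aprioriBounds`, line `Sketch` v7): for all `R`, `η > 0`, `τ > 0`, `κ > 0` there is `ε₀ > 0`
such that for every `0 < ε ≤ ε₀` there is `δ₀ > 0` with: for all meshes `0 < δ ≤ δ₀`, the
probability that some loop of `siteLoopConfig δ` meeting `B̄(0, R + 1)` with diameter `≥ η` has an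
`ε`-sausage of area `> τ` inside `B̄(0, R)` is at most `κ`.  By `volume_real_sausage_le_sum` such a
loop forces `τ < 16 ε² Σ_y N_y(ω)`, `N_y` the number of loops meeting `B̄(y, 3ε)` and leaving
`B(y, η/3)` over the `(2⌈|R|/ε⌉ + 1)²` grid points `y`; by Markov and the first-moment two-arm bound
`integral_ncard_loops_cross_le_tEns` (`c₀ δ ≤ 3ε`, `36 ε ≤ η`) the probability is at most
`16 ε² (2⌈|R|/ε⌉ + 1)² C (9ε/η)^c / τ ≤ 16 C (2|R| + 3)² (9/η)^c ε^c / τ ≤ κ` for `ε ≤ ε₀`. -/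
theorem apriori_sausage : ∀ (R η τ κ : ℝ), 0 < η → 0 < τ → 0 < κ → ∃ ε₀ : ℝ, 0 < ε₀ ∧
    ∀ ε : ℝ, 0 < ε → ε ≤ ε₀ → ∃ δ₀ : ℝ, 0 < δ₀ ∧ ∀ δ : ℝ, 0 < δ → δ ≤ δ₀ →
      (triSitePercolation half) {ω | ∃ u ∈ (siteLoopConfig δ ω).loops,
        (u.range ∩ Metric.closedBall (0 : ℂ) (R + 1)).Nonempty ∧ η ≤ Metric.diam u.range ∧
        τ < volume.real ({z : ℂ | Metric.infDist z u.range ≤ ε} ∩ Metric.closedBall (0 : ℂ) R)} ≤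
        ENNReal.ofReal κ := by
  intro R η τ κ hη hτ hκ
  haveI : IsProbabilityMeasure tEns.P :=
    inferInstanceAs (IsProbabilityMeasure (triSitePercolation half))
  obtain ⟨c, C, c₀, hc, hC, hc₀, hE⟩ := integral_ncard_loops_cross_le_tEns
  -- the constant in front of `ε^c` in the final bound, and the admissible size of `ε^c`
  set A : ℝ := 16 * C * (2 * |R| + 3) ^ 2 * (9 / η) ^ c / τ with hA
  have hA0 : 0 < A := by positivity
  set L : ℝ := κ / A with hL
  have hL0 : 0 < L := div_pos hκ hA0
  refine ⟨min (min 1 (η / 36)) (L ^ (1 / c)),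
    lt_min (lt_min one_pos (by positivity)) (Real.rpow_pos_of_pos hL0 _), fun ε hε hεle ↦ ?_⟩
  have hε1 : ε ≤ 1 := hεle.trans ((min_le_left _ _).trans (min_le_left _ _))
  have hε36 : 36 * ε ≤ η := by
    have := hεle.trans ((min_le_left _ _).trans (min_le_right _ _))
    linarith
  have hεL : ε ^ c ≤ L := by
    have h1 : ε ≤ L ^ (1 / c) := hεle.trans (min_le_right _ _)
    calc ε ^ c ≤ (L ^ (1 / c)) ^ c := Real.rpow_le_rpow hε.le h1 hc.le
      _ = L := by rw [← Real.rpow_mul hL0.le, one_div_mul_cancel hc.ne', Real.rpow_one]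
  refine ⟨3 * ε / c₀, by positivity, fun δ hδ hδ₀ ↦ ?_⟩
  have hc₀δ : c₀ * δ ≤ 3 * ε := by
    calc c₀ * δ ≤ c₀ * (3 * ε / c₀) := mul_le_mul_of_nonneg_left hδ₀ hc₀.le
      _ = 3 * ε := mul_div_cancel₀ _ hc₀.ne'
  have h4 : 4 * (3 * ε) ≤ η / 3 := by linarith
  -- grid data
  set N : ℕ := ⌈|R| / ε⌉₊ with hN
  set box : Finset (ℤ × ℤ) := Finset.Icc (-(N : ℤ)) N ×ˢ Finset.Icc (-(N : ℤ)) N with hbox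
  set g : ℤ × ℤ → ℂ := fun p ↦ ⟨p.1 * ε, p.2 * ε⟩ with hg
  -- the crossing counts around the grid points and their sum
  set cnt : ℤ × ℤ → SiteConfig (Site 2) → ℕ := fun p ω ↦
    {u ∈ (tEns.X δ ω).loops | (u.range ∩ Metric.closedBall (g p) (3 * ε)).Nonempty ∧
      (u.range ∩ (Metric.ball (g p) (η / 3))ᶜ).Nonempty}.ncard with hcnt
  set Ssum : SiteConfig (Site 2) → ℝ := fun ω ↦ ∑ p ∈ box, (cnt p ω : ℝ) with hSsum
  have hint : ∀ p, Integrable (fun ω ↦ (cnt p ω : ℝ)) tEns.P := fun p ↦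
    (hE (g p) (3 * ε) (η / 3) δ hδ hc₀δ h4).1
  have hexp : ∀ p, ∫ ω, (cnt p ω : ℝ) ∂tEns.P ≤ C * (3 * ε / (η / 3)) ^ c := fun p ↦
    (hE (g p) (3 * ε) (η / 3) δ hδ hc₀δ h4).2
  have hSint : Integrable Ssum tEns.P := integrable_finsetSum box fun p _ ↦ hint p
  have hSnn : 0 ≤ᵐ[tEns.P] Ssum :=
    Eventually.of_forall fun ω ↦ Finset.sum_nonneg fun p _ ↦ Nat.cast_nonneg _
  have hSexp : ∫ ω, Ssum ω ∂tEns.P ≤ box.card * (C * (3 * ε / (η / 3)) ^ c) := by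
    calc ∫ ω, Ssum ω ∂tEns.P = ∑ p ∈ box, ∫ ω, (cnt p ω : ℝ) ∂tEns.P :=
          integral_finsetSum box fun p _ ↦ hint p
      _ ≤ ∑ p ∈ box, C * (3 * ε / (η / 3)) ^ c := Finset.sum_le_sum fun p _ ↦ hexp p
      _ = box.card * (C * (3 * ε / (η / 3)) ^ c) := by rw [Finset.sum_const, nsmul_eq_mul]
  -- the event lies in the Markov event `{τ / (16 ε²) ≤ Ssum}`
  set t : ℝ := τ / (16 * ε ^ 2) with ht
  have ht0 : 0 < t := by positivity
  have hsub : {ω | ∃ u ∈ (siteLoopConfig δ ω).loops,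
        (u.range ∩ Metric.closedBall (0 : ℂ) (R + 1)).Nonempty ∧ η ≤ Metric.diam u.range ∧
        τ < volume.real ({z : ℂ | Metric.infDist z u.range ≤ ε} ∩ Metric.closedBall (0 : ℂ) R)} ⊆
      {ω | t ≤ Ssum ω} := by
    rintro ω ⟨u, hu, -, hηu, hτu⟩
    have hvol := volume_real_sausage_le_sum u.isCompact_range u.range_nonempty R hε hη hηu
      (fun p ↦ 16 * ε ^ 2 * (cnt p ω : ℝ)) (fun p ↦ by positivity) (fun p h1 h2 ↦ by
        -- `u` is one of the loops counted by `cnt p ω`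
        obtain ⟨M, hM⟩ :=
          LoopCrossCount.exists_ncard_cross_le tEns tEns_mem hδ (g p) (3 * ε) (η / 3)
        have hmem : u ∈ {u ∈ (tEns.X δ ω).loops |
            (u.range ∩ Metric.closedBall (g p) (3 * ε)).Nonempty ∧
              (u.range ∩ (Metric.ball (g p) (η / 3))ᶜ).Nonempty} := ⟨hu, h1, h2⟩
        have hpos : 0 < cnt p ω := (Set.ncard_pos (hM ω).1).2 ⟨u, hmem⟩
        have h1 : (1 : ℝ) ≤ (cnt p ω : ℝ) :=
          Nat.one_le_cast.2 (Nat.one_le_iff_ne_zero.2 hpos.ne')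
        exact le_mul_of_one_le_right (by positivity) h1)
    show t ≤ Ssum ω
    rw [ht, div_le_iff₀ (by positivity)]
    simp only [hSsum]
    have : ∑ p ∈ box, 16 * ε ^ 2 * (cnt p ω : ℝ) = (∑ p ∈ box, (cnt p ω : ℝ)) * (16 * ε ^ 2) := by
      rw [Finset.sum_mul]
      exact Finset.sum_congr rfl fun p _ ↦ mul_comm _ _
    linarith [hvol.trans_eq this]
  -- Markov's inequality and the arithmetic
  have hmarkov := mul_meas_ge_le_integral_of_nonneg hSnn hSint t
  have hNε : (N : ℝ) * ε ≤ |R| + ε := by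
    have h1 : (N : ℝ) < |R| / ε + 1 := Nat.ceil_lt_add_one (by positivity)
    have := mul_le_mul_of_nonneg_right h1.le hε.le
    rwa [add_mul, one_mul, div_mul_cancel₀ _ hε.ne'] at this
  have hIcc : (Finset.Icc (-(N : ℤ)) N).card = 2 * N + 1 := by
    rw [Int.card_Icc]
    omega
  have hcard : (box.card : ℝ) = (2 * N + 1) ^ 2 := by
    rw [hbox, Finset.card_product, hIcc]
    push_cast
    ring
  have hratio : (3 * ε / (η / 3)) ^ c = (9 / η) ^ c * ε ^ c := by
    rw [show 3 * ε / (η / 3) = 9 / η * ε by ring, Real.mul_rpow (by positivity) hε.le]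
  have hw : (2 * N + 1) * ε ≤ 2 * |R| + 3 := by
    have : (2 * (N : ℝ) + 1) * ε = 2 * (N * ε) + ε := by ring
    linarith [abs_nonneg R]
  have hw0 : (0 : ℝ) ≤ (2 * N + 1) * ε := by positivity
  have harith : (box.card : ℝ) * (C * (3 * ε / (η / 3)) ^ c) ≤ κ * t := by
    rw [ht, mul_div_assoc', le_div_iff₀ (by positivity), hcard, hratio]
    calc ((2 * N + 1 : ℝ)) ^ 2 * (C * ((9 / η) ^ c * ε ^ c)) * (16 * ε ^ 2)
        = 16 * C * ((2 * N + 1) * ε) ^ 2 * (9 / η) ^ c * ε ^ c := by ring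
      _ ≤ 16 * C * (2 * |R| + 3) ^ 2 * (9 / η) ^ c * ε ^ c := by gcongr
      _ = A * τ * ε ^ c := by rw [hA]; field_simp
      _ ≤ A * τ * L := by gcongr
      _ = κ * τ := by rw [hL]; field_simp
  have hreal : tEns.P.real {ω | t ≤ Ssum ω} ≤ κ := by
    have h1 : tEns.P.real {ω | t ≤ Ssum ω} ≤ (∫ ω, Ssum ω ∂tEns.P) / t := by
      rw [le_div_iff₀' ht0]
      exact hmarkov
    refine h1.trans ?_
    rw [div_le_iff₀ ht0]
    exact hSexp.trans harith
  calc (triSitePercolation half) {ω | ∃ u ∈ (siteLoopConfig δ ω).loops,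
        (u.range ∩ Metric.closedBall (0 : ℂ) (R + 1)).Nonempty ∧ η ≤ Metric.diam u.range ∧
        τ < volume.real ({z : ℂ | Metric.infDist z u.range ≤ ε} ∩ Metric.closedBall (0 : ℂ) R)}
      ≤ tEns.P {ω | t ≤ Ssum ω} := measure_mono hsub
    _ = ENNReal.ofReal (tEns.P.real {ω | t ≤ Ssum ω}) :=
        (ofReal_measureReal (measure_ne_top _ _)).symm
    _ ≤ ENNReal.ofReal κ := ENNReal.ofReal_le_ofReal hreal

end Summit.CriticalPhenomena.CardyFormulaZ2.Cruxes.MagicFormulaT.LineSketch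

end
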